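/-
Copyright (c) 2026 the pub-hodgecm-mathlib formalisation cell (harness21).  Prover seat hodgecm-mathlib-LH10-p01 (g3): line LH4 (dyadic pay-down of `stub_N6nsDyadic`),
organ (D-SH) «Shalika at `Φ₃` at dyadic non-split places», brick (R-dy) «RAO REGULAR CLASS AT A DYADIC PLACE», FILE 1 (LH4-plan (g3) DEALER WORD #1); 2026-09-02.
-/
import Literature.NumberTheory.Automorphic.UnitaryThreeRegularUnipotentCentralizerBalls   -- ★ p849366 (LH5-p02): scalar centraliser balls + the ODD-place absorption; brings ★ REG-FRAME `UnitaryThreeRegularUnipotentOrbitFrame`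
import HarnessLib

/-!
# The regular unipotent orbit frame of the quasi-split `U(3)` WITHOUT `2 ∈ 𝒪^×`: the coset criterion and the absorption at an arbitrary (possibly DYADIC) valued field
(Rogawski 1990 §3.9, §8.1; Ranga Rao 1972 — the valuation bookkeeping of the shell decomposition of a regular unipotent orbit, residue characteristic 2 allowed)

Topic `NumberTheory/Automorphic`; namespace `Literature.NumberTheory.Automorphic.UnitaryGroup`.  THEOREMS ONLY (no definition, no instance, no notation, no named fact,
no `sorry`); kernel lane `--supports stmt-HodgeConjecture-24833`.  Cell `pub/hodgecm-mathlib` (D-0151), crux H413 = `stmt-HodgeConjecture-24833`; half A line LH4, the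
DYADIC pay-down skeleton of the closer row `stub_N6nsDyadic` (LH4-plan (g3)), organ (D-SH), brick (R-dy) = the REGULAR class of the Ranga-Rao clause at a dyadic non-split
place (census `DYADIC-CENSUS.v1.md` §6, LH4-p02 (g2)).  FILE 1 of 4: the two field-level lemmas of ★ REG-FRAME §5 ∕ ★ (A2) `UnitaryThreeRegularUnipotentCentralizerBalls` §3 whose
proofs use `v 2 = 1`, re-proved for an ARBITRARY value `v 2 = exp(−c₂)` (`c₂ = ord 2 ≥ 0`; `c₂ = 0` is the odd case and gives back the ★ statements).

THE MATHEMATICS.  Frame of ★ REG-FRAME: `d = diag(z, 1, (σz)⁻¹)`, transversal `m_κ = !![1, κξ, κ²ξ²∕2; 0, 1, κξ; 0, 0, 1]`, centraliser coordinates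
`n(a,s) = !![1, a, s − a²∕2; 0, 1, −a; 0, 0, 1]`.  The ONLY entries of `d^j m_κ d^{−j}` and `d^j (m_κ (ζ•n(a,s)) m_κ⁻¹) d^{−j}` where `2` enters are the CORNERS
`(zσz)^j κ²ξ²∕2` and `(zσz)^j (s − 2κξa − a²∕2)`: `v(2κξa) ≤ v(κξ)·v(a)` holds at every residue characteristic (`v 2 ≤ 1`), while `v(κ²ξ²∕2) = v(κξ)²∕v(2)` and
`v(a²∕2) = v(a)²∕v(2)` LOSE the factor `v(2) = exp(−c₂)`.  Hence:
* COSET CRITERION (c₂-free form): `d^j m_κ d^{−j}` is integral iff `V ≤ 1 ∧ V·V ≤ v 2`, `V = v(z^j κξ)` (★ `isIntMatrix_torusZpow_conj_transversal_iff` is the case `v 2 = 1`);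
  sufficient: `v(κξ) ≤ exp(j − c₂)` (`v z = exp(−1)`) — so the `K d^j`-cosets of the transversal are counted modulo the ball `B(j − e − c₂)` instead of `B(j − e)`.
* ABSORPTION with scalar and general radii: the ★ (A2) statement with the single change `−j ≤ nₐ` ↦ `−j + c₂ ≤ nₐ` (the `a`-radius absorbs `ord 2`).

* §1 `valued_v_two_le_one`, `exists_valued_v_two_eq_exp` — `v 2 ≤ 1`, and `v 2 = exp(−c₂)` for some `c₂ : ℕ` when `2 ≠ 0`.
* §2 `isIntMatrix_torusZpow_conj_transversal_iff'` (criterion), `isIntMatrix_torusZpow_conj_transversal_of_le` (sufficient radius `exp(j − c₂)`).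
* §3 `isIntMatrix_torusZpow_conj_transversal_conj_scalarRegCent'` (absorption, `−j + c₂ ≤ nₐ`).
HONEST LABEL: elementary valuation algebra; count-neutral, pays no letter; HC_CM is proved only modulo the 7 printed citations (2 remaining: hLiu418 = stmt-HodgeConjecture-24832,
h413 = stmt-HodgeConjecture-24833) until rung 0 closes.

## References
* [Rogawski1990] J. D. Rogawski, *Automorphic Representations of Unitary Groups in Three Variables*, Ann. of Math. Stud. 123 (1990), §3.9 p. 32; §8.1 p. 112.
* [Rao1972] R. Ranga Rao, *Orbital integrals in reductive groups*, Ann. of Math. (2) 96 (1972) 505–510, Theorem (p. 505).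
-/

set_option autoImplicit false

open Matrix
open scoped Valued WithZero

namespace Literature.NumberTheory.Automorphic.UnitaryGroup

open Literature.NumberTheory.Automorphic.HermitianLattice Literature.NumberTheory.Automorphic.UnitaryLatticeTree

variable {K : Type*} [Field K] (σ : K →+* K)

section Valued

variable [Valued K ℤᵐ⁰]

/-! ## §1 The value of `2` -/

omit σ in
/-- `v 2 ≤ 1` in every valued field (`2 = 1 + 1`). [cite: Rogawski1990, §8.1 p. 112] -/
theorem valued_v_two_le_one : Valued.v (2 : K) ≤ 1 := by
  rw [show (2 : K) = 1 + 1 by norm_num]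
  exact (Valuation.map_add _ _ _).trans (max_le (le_of_eq (Valuation.map_one _)) (le_of_eq (Valuation.map_one _)))

omit σ in
/-- `v 2 = exp(−c₂)` for some `c₂ : ℕ` (the order of `2`) as soon as `2 ≠ 0`. [cite: Rogawski1990, §8.1 p. 112] -/
theorem exists_valued_v_two_eq_exp (h2 : (2 : K) ≠ 0) : ∃ c₂ : ℕ, Valued.v (2 : K) = WithZero.exp (-(c₂ : ℤ)) := by
  have h0 : Valued.v (2 : K) ≠ 0 := (Valuation.ne_zero_iff _).2 h2
  obtain ⟨e, he⟩ := WithZero.ne_zero_iff_exists.1 h0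
  have hle : WithZero.exp (Multiplicative.toAdd e) ≤ WithZero.exp (0 : ℤ) := by
    rw [WithZero.exp_zero]
    have h : (WithZero.exp (Multiplicative.toAdd e) : ℤᵐ⁰) = Valued.v (2 : K) := by rw [← he]; rfl
    rw [h]; exact valued_v_two_le_one
  have hn : Multiplicative.toAdd e ≤ 0 := WithZero.exp_le_exp.1 hle
  refine ⟨(-Multiplicative.toAdd e).toNat, ?_⟩
  rw [Int.toNat_of_nonneg (by omega), neg_neg, ← he]; rfl

/-! ## §2 The coset criterion without `v 2 = 1` -/

/-- = ★ `isIntMatrix_torusZpow_conj_transversal_iff` with the hypothesis `2 ∈ 𝒪_w^×` (`v 2 = 1`) deleted (the conclusion gains the conjunct `V·V ≤ v 2`).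
**COSET CRITERION at any residue characteristic**: `d^j · m_κ · d^{−j}` (`= !![1, z^j κξ, (zσz)^j κ²ξ²∕2; 0, 1, (σz)^j κξ; 0, 0, 1]`) is INTEGRAL iff `V ≤ 1` and
`V·V ≤ v 2`, where `V = v (z^j κξ)` (`σ` isometric, `2 ≠ 0`).  At `v 2 = 1` the second condition follows from the first (★ `isIntMatrix_torusZpow_conj_transversal_iff`).
[cite: Rogawski1990, §8.1 p. 112] [cite: Rao1972, Theorem] -/
theorem isIntMatrix_torusZpow_conj_transversal_iff' (hσv : ∀ x : K, Valued.v (σ x) = Valued.v x) (h2 : (2 : K) ≠ 0)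
    {z ξ κ : K} (hz0 : z ≠ 0) (j : ℤ) {d m : GL (Fin 3) K} (hd : (d : Matrix (Fin 3) (Fin 3) K) = Matrix.diagonal ![z, 1, (σ z)⁻¹])
    (hm : (m : Matrix (Fin 3) (Fin 3) K) = !![1, κ * ξ, κ ^ 2 * ξ ^ 2 / 2; 0, 1, κ * ξ; 0, 0, 1]) :
    IsIntMatrix ((d ^ j * m * (d ^ j)⁻¹ : GL (Fin 3) K) : Matrix (Fin 3) (Fin 3) K) ↔
      Valued.v (z ^ j * (κ * ξ)) ≤ 1 ∧ Valued.v (z ^ j * (κ * ξ)) * Valued.v (z ^ j * (κ * ξ)) ≤ Valued.v (2 : K) := by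
  have hconj := coe_torusElt_zpow_conj_upperTriangularUnipotent σ hz0 hd hm j
  have hvσ : Valued.v ((σ z) ^ j * (κ * ξ)) = Valued.v (z ^ j * (κ * ξ)) := by simp only [Valuation.map_mul, map_zpow₀, hσv]
  have hv2 : Valued.v (2 : K) ≠ 0 := (Valuation.ne_zero_iff _).2 h2
  have hcorner : Valued.v ((z * σ z) ^ j * (κ ^ 2 * ξ ^ 2 / 2)) = Valued.v (z ^ j * (κ * ξ)) * Valued.v (z ^ j * (κ * ξ)) / Valued.v (2 : K) := by
    rw [show (z * σ z) ^ j * (κ ^ 2 * ξ ^ 2 / 2) = (z ^ j * (κ * ξ)) * ((σ z) ^ j * (κ * ξ)) / 2 by rw [mul_zpow]; ring, map_div₀, Valuation.map_mul, hvσ]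
  rw [isIntMatrix_upperTriangularUnipotent_iff hconj, hvσ, hcorner, div_le_iff₀ (zero_lt_iff.2 hv2), one_mul]
  constructor
  · rintro ⟨h, h', -⟩; exact ⟨h, h'⟩
  · rintro ⟨h, h'⟩; exact ⟨h, h', h⟩

/-- **Sufficient radius for the coset criterion**: with `v z = exp(−1)` and `v 2 = exp(−c₂)`, `v(κξ) ≤ exp(j − c₂)` makes `d^j · m_κ · d^{−j}` integral — the
`K d^j`-cosets of the transversal are constant on balls of the `κ`-line of radius `exp(j − e − c₂)` (`v ξ = exp e`). [cite: Rogawski1990, §8.1 p. 112] [cite: Rao1972, Theorem] -/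
theorem isIntMatrix_torusZpow_conj_transversal_of_le (hσv : ∀ x : K, Valued.v (σ x) = Valued.v x) {c₂ : ℕ} (hv2 : Valued.v (2 : K) = WithZero.exp (-(c₂ : ℤ)))
    {z ξ κ : K} (hz : Valued.v z = WithZero.exp (-1 : ℤ)) (j : ℤ) {d m : GL (Fin 3) K} (hd : (d : Matrix (Fin 3) (Fin 3) K) = Matrix.diagonal ![z, 1, (σ z)⁻¹])
    (hm : (m : Matrix (Fin 3) (Fin 3) K) = !![1, κ * ξ, κ ^ 2 * ξ ^ 2 / 2; 0, 1, κ * ξ; 0, 0, 1]) (hκ : Valued.v (κ * ξ) ≤ WithZero.exp (j - c₂)) :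
    IsIntMatrix ((d ^ j * m * (d ^ j)⁻¹ : GL (Fin 3) K) : Matrix (Fin 3) (Fin 3) K) := by
  have hz0 : z ≠ 0 := (Valuation.ne_zero_iff _).1 (by rw [hz]; exact WithZero.coe_ne_zero)
  have h2 : (2 : K) ≠ 0 := (Valuation.ne_zero_iff _).1 (by rw [hv2]; exact WithZero.coe_ne_zero)
  have hvz : Valued.v (z ^ j) = WithZero.exp (-j) := by rw [map_zpow₀, hz, ← WithZero.exp_zsmul]; congr 1; ring
  have hV : Valued.v (z ^ j * (κ * ξ)) ≤ WithZero.exp (-(c₂ : ℤ)) := by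
    rw [Valuation.map_mul, hvz]
    calc WithZero.exp (-j) * Valued.v (κ * ξ) ≤ WithZero.exp (-j) * WithZero.exp (j - c₂) := mul_le_mul_right hκ _
      _ = WithZero.exp (-(c₂ : ℤ)) := by rw [← WithZero.exp_add]; congr 1; ring
  refine (isIntMatrix_torusZpow_conj_transversal_iff' σ hσv h2 hz0 j hd hm).2 ⟨hV.trans ?_, ?_⟩
  · rw [← WithZero.exp_zero]; exact WithZero.exp_le_exp.2 (by omega)
  · rw [hv2]
    calc Valued.v (z ^ j * (κ * ξ)) * Valued.v (z ^ j * (κ * ξ)) ≤ WithZero.exp (-(c₂ : ℤ)) * WithZero.exp (-(c₂ : ℤ)) := mul_le_mul' hV hV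
      _ ≤ WithZero.exp (-(c₂ : ℤ)) := by rw [← WithZero.exp_add]; exact WithZero.exp_le_exp.2 (by omega)

/-! ## §3 Absorption with a scalar and general radii, without `v 2 = 1` -/

/-- = ★ `isIntMatrix_torusZpow_conj_transversal_conj_scalarRegCent` with the hypothesis `2 ∈ 𝒪_w^×` (`v 2 = 1`) deleted (replaced by the value `v 2 = exp(−c₂)`,
the `a`-radius condition `−j ≤ nₐ` becoming `−j + c₂ ≤ nₐ`).  **ABSORPTION WITH A SCALAR AND GENERAL RADII at any residue characteristic**: `σ` isometric, `v 2 = exp(−c₂)`, `v z = exp(−1)`; radii: `v a ≤ exp(−nₐ)`, `v s ≤ exp(2j)`,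
`v(κξ) ≤ exp(r′ + 2j)` with `r′ ≤ nₐ` and `−j + c₂ ≤ nₐ`; `σζ·ζ = 1`.  Then `d^j · (m_κ · (ζ • n(a,s)) · m_κ⁻¹) · d^{−j}` is INTEGRAL together with its inverse (its matrix is
`ζ • !![1, z^j a, (zσz)^j(s − 2κξa − a²∕2); 0, 1, −(σz)^j a; 0, 0, 1]`).  ★ (A2) `isIntMatrix_torusZpow_conj_transversal_conj_scalarRegCent` is the case `c₂ = 0`; the one change is
the `a`-radius condition `−j + c₂ ≤ nₐ`, which pays for `v(a²∕2) = v(a)²·exp(c₂)`. [cite: Rogawski1990, §8.1 p. 112] [cite: Rao1972, Theorem] -/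
theorem isIntMatrix_torusZpow_conj_transversal_conj_scalarRegCent' (hσv : ∀ x : K, Valued.v (σ x) = Valued.v x) {c₂ : ℕ} (hv2 : Valued.v (2 : K) = WithZero.exp (-(c₂ : ℤ)))
    {z ξ κ ζ a s : K} (hz : Valued.v z = WithZero.exp (-1 : ℤ)) {j na r' : ℤ} (hrn : r' ≤ na) (hjn : -j + c₂ ≤ na)
    (hζ : σ ζ * ζ = 1) (ha : Valued.v a ≤ WithZero.exp (-na)) (hs : Valued.v s ≤ WithZero.exp (2 * j)) (hκ : Valued.v (κ * ξ) ≤ WithZero.exp (r' + 2 * j))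
    {d m g : GL (Fin 3) K} (hd : (d : Matrix (Fin 3) (Fin 3) K) = Matrix.diagonal ![z, 1, (σ z)⁻¹])
    (hm : (m : Matrix (Fin 3) (Fin 3) K) = !![1, κ * ξ, κ ^ 2 * ξ ^ 2 / 2; 0, 1, κ * ξ; 0, 0, 1])
    (hg : (g : Matrix (Fin 3) (Fin 3) K) = ζ • !![1, a, s - a ^ 2 / 2; 0, 1, -a; 0, 0, 1]) :
    IsIntMatrix ((d ^ j * (m * g * m⁻¹) * (d ^ j)⁻¹ : GL (Fin 3) K) : Matrix (Fin 3) (Fin 3) K) ∧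
      IsIntMatrix ((((d ^ j * (m * g * m⁻¹) * (d ^ j)⁻¹)⁻¹ : GL (Fin 3) K)) : Matrix (Fin 3) (Fin 3) K) := by
  have hz0 : z ≠ 0 := (Valuation.ne_zero_iff _).1 (by rw [hz]; exact WithZero.coe_ne_zero)
  have hζ0 : ζ ≠ 0 := right_ne_zero_of_mul_eq_one hζ
  have hv20 : Valued.v (2 : K) ≠ 0 := by rw [hv2]; exact WithZero.coe_ne_zero
  have hvζ : Valued.v ζ = 1 := by
    have h := congrArg Valued.v hζ
    rw [map_mul, hσv, map_one] at h
    rcases le_or_gt (Valued.v ζ) 1 with hle | hgt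
    · rcases hle.eq_or_lt with heq | hlt
      · exact heq
      · exfalso
        have : Valued.v ζ * Valued.v ζ < 1 := by
          calc Valued.v ζ * Valued.v ζ ≤ Valued.v ζ * 1 := mul_le_mul_right hle _
            _ = Valued.v ζ := mul_one _
            _ < 1 := hlt
        exact this.ne h
    · exfalso
      have : 1 < Valued.v ζ * Valued.v ζ := by
        calc (1 : ℤᵐ⁰) < Valued.v ζ := hgt
          _ = Valued.v ζ * 1 := (mul_one _).symm
          _ ≤ Valued.v ζ * Valued.v ζ := mul_le_mul_right hgt.le _
      exact this.ne' h
  -- the unipotent part as a unit `g₁`, `g = s_ζ · g₁` with `s_ζ = diag(ζ, ζ, ζ)`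
  obtain ⟨g₁, hg₁, -⟩ := exists_units_coe_eq_upperTriangularUnipotent a (s - a ^ 2 / 2) (-a)
  obtain ⟨sζ, hsζ, hsζ'⟩ := exists_units_coe_eq_torusS (K := K) hζ0 hζ0
  have hscal : ∀ M : Matrix (Fin 3) (Fin 3) K, Matrix.diagonal ![ζ, ζ, ζ] * M = ζ • M ∧ M * Matrix.diagonal ![ζ, ζ, ζ] = ζ • M := by
    intro M
    have e : Matrix.diagonal ![ζ, ζ, ζ] = ζ • (1 : Matrix (Fin 3) (Fin 3) K) := by
      ext i j; fin_cases i <;> fin_cases j <;> simp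
    rw [e, Matrix.smul_mul, Matrix.mul_smul, Matrix.one_mul, Matrix.mul_one]
    exact ⟨rfl, rfl⟩
  have hggs : g = sζ * g₁ := Units.ext (by rw [Units.val_mul, hsζ, (hscal _).1, hg₁, hg])
  -- `s_ζ` is central: the conjugate splits as `s_ζ · (d^j (m g₁ m⁻¹) d^{−j})`
  have hcomm : ∀ h : GL (Fin 3) K, h * sζ = sζ * h := fun h => Units.ext (by rw [Units.val_mul, Units.val_mul, hsζ, (hscal _).1, (hscal _).2])
  have hsplit : d ^ j * (m * g * m⁻¹) * (d ^ j)⁻¹ = sζ * (d ^ j * (m * g₁ * m⁻¹) * (d ^ j)⁻¹) := by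
    rw [hggs]
    calc d ^ j * (m * (sζ * g₁) * m⁻¹) * (d ^ j)⁻¹ = d ^ j * (sζ * (m * g₁ * m⁻¹)) * (d ^ j)⁻¹ := by
          rw [← mul_assoc m sζ g₁, hcomm m, mul_assoc sζ m g₁, mul_assoc sζ (m * g₁) m⁻¹]
      _ = sζ * (d ^ j * (m * g₁ * m⁻¹) * (d ^ j)⁻¹) := by
          rw [← mul_assoc (d ^ j) sζ, hcomm (d ^ j), mul_assoc sζ (d ^ j), mul_assoc sζ (d ^ j * (m * g₁ * m⁻¹))]
  -- the unipotent factor and its integrality (★ (A2)'s computation; the two `2`-sensitive corner terms re-estimated)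
  have hconj := coe_torusElt_zpow_conj_upperTriangularUnipotent σ hz0 hd (coe_transversal_conj_regCentElt hm hg₁) j
  have hvz : Valued.v (z ^ j) = WithZero.exp (-j) := by rw [map_zpow₀, hz, ← WithZero.exp_zsmul]; congr 1; ring
  have hvσz : Valued.v ((σ z) ^ j) = WithZero.exp (-j) := by rw [map_zpow₀, hσv, hz, ← WithZero.exp_zsmul]; congr 1; ring
  have hvN : Valued.v ((z * σ z) ^ j) = WithZero.exp (-(2 * j)) := by
    rw [map_zpow₀, Valuation.map_mul, hσv, hz, ← WithZero.exp_add, ← WithZero.exp_zsmul]; congr 1; ring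
  have h01 : Valued.v (z ^ j * a) ≤ 1 := by
    rw [Valuation.map_mul, hvz]
    calc WithZero.exp (-j) * Valued.v a ≤ WithZero.exp (-j) * WithZero.exp (-na) := mul_le_mul_right ha _
      _ ≤ 1 := by rw [← WithZero.exp_add, ← WithZero.exp_zero]; exact WithZero.exp_le_exp.2 (by omega)
  have h12 : Valued.v ((σ z) ^ j * -a) ≤ 1 := by
    rw [Valuation.map_mul, Valuation.map_neg, hvσz]
    calc WithZero.exp (-j) * Valued.v a ≤ WithZero.exp (-j) * WithZero.exp (-na) := mul_le_mul_right ha _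
      _ ≤ 1 := by rw [← WithZero.exp_add, ← WithZero.exp_zero]; exact WithZero.exp_le_exp.2 (by omega)
  have h02 : Valued.v ((z * σ z) ^ j * ((s - 2 * κ * ξ * a) - a ^ 2 / 2)) ≤ 1 := by
    have hinner : Valued.v ((s - 2 * κ * ξ * a) - a ^ 2 / 2) ≤ WithZero.exp (2 * j) := by
      refine (Valuation.map_sub _ _ _).trans (max_le ((Valuation.map_sub _ _ _).trans (max_le hs ?_)) ?_)
      · rw [show 2 * κ * ξ * a = 2 * (κ * ξ) * a by ring, Valuation.map_mul, Valuation.map_mul]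
        calc Valued.v (2 : K) * Valued.v (κ * ξ) * Valued.v a ≤ 1 * WithZero.exp (r' + 2 * j) * WithZero.exp (-na) :=
              mul_le_mul' (mul_le_mul' valued_v_two_le_one hκ) ha
          _ ≤ WithZero.exp (2 * j) := by rw [one_mul, ← WithZero.exp_add]; exact WithZero.exp_le_exp.2 (by omega)
      · rw [map_div₀, hv2, Valuation.map_pow, div_le_iff₀ (zero_lt_iff.2 (hv2 ▸ hv20)), ← WithZero.exp_add]
        calc Valued.v a ^ 2 ≤ WithZero.exp (-na) ^ 2 := pow_le_pow_left₀ zero_le ha 2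
          _ = WithZero.exp (-na + -na) := by rw [pow_two, WithZero.exp_add]
          _ ≤ WithZero.exp (2 * j + -(c₂ : ℤ)) := WithZero.exp_le_exp.2 (by omega)
    rw [Valuation.map_mul, hvN]
    calc WithZero.exp (-(2 * j)) * Valued.v ((s - 2 * κ * ξ * a) - a ^ 2 / 2)
        ≤ WithZero.exp (-(2 * j)) * WithZero.exp (2 * j) := mul_le_mul' le_rfl hinner
      _ = 1 := by rw [← WithZero.exp_add, neg_add_cancel, WithZero.exp_zero]
  have hX : IsIntMatrix ((d ^ j * (m * g₁ * m⁻¹) * (d ^ j)⁻¹ : GL (Fin 3) K) : Matrix (Fin 3) (Fin 3) K) :=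
    (isIntMatrix_upperTriangularUnipotent_iff hconj).2 ⟨h01, h02, h12⟩
  have hXi : IsIntMatrix ((((d ^ j * (m * g₁ * m⁻¹) * (d ^ j)⁻¹)⁻¹ : GL (Fin 3) K)) : Matrix (Fin 3) (Fin 3) K) :=
    isIntMatrix_inv_of_upperTriangularUnipotent hconj h01 h02 h12
  -- the scalar factor is integral with integral inverse
  have hsI : IsIntMatrix (sζ : Matrix (Fin 3) (Fin 3) K) := by
    rw [hsζ]; intro i k; fin_cases i <;> fin_cases k <;> simp [hvζ]
  have hsI' : IsIntMatrix ((sζ⁻¹ : GL (Fin 3) K) : Matrix (Fin 3) (Fin 3) K) := by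
    rw [hsζ']; intro i k; fin_cases i <;> fin_cases k <;> simp [hvζ]
  rw [hsplit, _root_.mul_inv_rev, Units.val_mul, Units.val_mul]
  exact ⟨isIntMatrix_mul hsI hX, isIntMatrix_mul hXi hsI'⟩

end Valued

end Literature.NumberTheory.Automorphic.UnitaryGroup
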